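import Summits.AtomisticToContinuum.HydrodynamicLimit.Theorems.JParityClosureLocalSecondLawContactBundle
import Summits.AtomisticToContinuum.HydrodynamicLimit.Theorems.JParityClosureLocalSecondLawContactKernelCollapse

/-!
# K1 on the contact bundle, read both ways (crux `LocalSecondLaw`, stmt-AtomisticToContinuum-13081; line
`contact-asymmetry-information`, stub K1 `stub_relativeOddChaos`)

Lead a5.  Instantiation of the abstract collapse (`exists_pointwise_iff_budget`,
`Theorems/JParityClosureLocalSecondLawContactKernelCollapse.lean`) on the line's contact bundle (part C vocabulary): for an
ADMISSIBLE pair `(q, f)` the typed content of the registered stub `stub_relativeOddChaos` at `(κ, η)` — an integrable slack of mass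
`≤ η` with `RelOddChaosPtwise σ r τ φ q f N κ e` — is EQUIVALENT to the Maxwellisation budget `(1 − κ)·asymR ≤ 2·prodR + η`
(`relOddChaosPtwise_iff_budget`, registered anchor `contactK1_collapse`).  Hence the reshaped skeleton's K1∫
(`stub_relativeOddChaosInt`) is the typed K1 restricted to admissible pairs, which is all the composition uses.

References: S. Kullback, *Information Theory and Statistics* (1959), Ch. 2; H. Spohn, *Large Scale Dynamics of Interacting
Particles* (1991), Part I §3.
-/

noncomputable section

open scoped BigOperators Topology Classical MeasureTheory ENNReal InnerProductSpace
open Filter Set MeasureTheory Function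
open Literature.MathematicalPhysics.KineticTheory
open Literature.Analysis.FluidPDE
open Summit.AtomisticToContinuum.HydrodynamicLimit.Theorems.LocalSecondLawNegative
open Summit.AtomisticToContinuum.HydrodynamicLimit.Theorems.LocalSecondLawLedger

namespace Summit.AtomisticToContinuum.HydrodynamicLimit.Theorems.LocalSecondLawContact

variable {N : ℕ}

/-! ## The collapse on the contact bundle: K1 ⟺ the Maxwellisation budget, for admissible pairs -/

/-- **K1 on the bundle, read both ways**: for an admissible pair `(q, f)`, the typed content of `stub_relativeOddChaos` at
`(κ, η)` — an integrable slack of mass `≤ η` with `RelOddChaosPtwise` — is EQUIVALENT to `(1 − κ)·asymR ≤ 2·prodR + η`. -/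
theorem relOddChaosPtwise_iff_budget {σ r τ : ℝ} {φ : ℝ → T3 → ℝ} {q : Bundle → ℝ} {f : Pt1 → ℝ}
    (hAdm : Admissible σ r τ φ q f N) (κ η : ℝ) :
    (∃ e : Bundle → ℝ, Integrable e (bundleMeasure τ) ∧ ∫ p, e p ∂(bundleMeasure τ) ≤ η ∧
        RelOddChaosPtwise σ r τ φ q f N κ e) ↔
      (1 - κ) * asymR r τ φ q ≤ 2 * prodR σ r τ φ q f N + η := by
  obtain ⟨i1, i2, i3, i4, -⟩ := hAdm
  have h := exists_pointwise_iff_budget (measurePreserving_Rhat τ) Rhat_involutive i1 i2 i3 i4 κ η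
  unfold RelOddChaosPtwise prodR asymR
  rw [h]
  constructor <;> intro hh <;> linarith

/-- Registered anchor (`contactK1_collapse`): the bundle-level collapse as a closed statement. -/
theorem contactK1_collapse : ∀ {N : ℕ} {σ r τ : ℝ} {φ : ℝ → T3 → ℝ} {q : Bundle → ℝ} {f : Pt1 → ℝ}, Admissible σ r τ φ q f N → ∀ (κ η : ℝ), (∃ e : Bundle → ℝ, Integrable e (bundleMeasure τ) ∧ ∫ p, e p ∂(bundleMeasure τ) ≤ η ∧ RelOddChaosPtwise σ r τ φ q f N κ e) ↔ (1 - κ) * asymR r τ φ q ≤ 2 * prodR σ r τ φ q f N + η :=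
  fun hAdm κ η => relOddChaosPtwise_iff_budget hAdm κ η

end Summit.AtomisticToContinuum.HydrodynamicLimit.Theorems.LocalSecondLawContact

end
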